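import Summits.KontsevichZagierPeriods.Zeta5Search.Certificates.RecordRayDecay
import Summits.KontsevichZagierPeriods.Zeta5Search.Certificates.RecordRayGrowthSharp
import Summits.KontsevichZagierPeriods.Zeta5Search.DualSeriesSharpConstant
import HarnessLib

/-!
# ζ(5) search — the record ray's DENOMINATORS, I: the Brown–Zudilin (35) multiplier and the rational-multiplier exponent (TYPER g15)

HONEST FRAMING: systematic search; no irrationality claim unless certified.

OUR work (Summit side; typer seat, generation 15).  `Certificates/RecordRayDecay.record_exponent_unconditional_decay`
(cert-2) leaves ONE hypothesis open for a hypothesis-free effective exponent of Brown–Zudilin's record approximations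
`P_n/Q(a·n) → ζ(5)` (`a = (8,16,10,15,12,16,18,13)`, arXiv:2210.03391 Thm 1): the DENOMINATORS `(HD)`.  This file starts
their kernel assembly.

* `record_exponent_rat` — the exponent step for a RATIONAL multiplier: if eventually `0 < M_n`, `M_n·P_n ∈ ℤ`, `M_n·Q(a·n) ∈ ℤ`
  and `M_n ≤ e^{λn}`, then for every `γ ≥ 0` with `γ·(λ + 85.08768884) < 85.08768883 + 31.5452` eventually
  `|ζ(5) − P_n/Q(a·n)| < 1/q_n^γ` with the INTEGERS `p_n = M_nP_n`, `q_n = M_n|Q(a·n)| ≥ 1` (decay `RecordRayDecay`, growth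
  `RecordRayGrowthSharp/Upper`, inequality `RecordRayExponent.abs_sub_div_lt_of_bounds`).  A rational multiplier lets
  `p`-powers be REMOVED window by window (`Literature…Hata1992.PrimeWindows`) — the sequel files do exactly that.
* `M0 n = d_{41n}⁹ · N♯(b) · N♯(b′) / |ρ(a·n)|` (`b = bRecord n`, `b′ = b + e₇`, `N♯ = DualSeriesDenominators.sharpNormaliser`,
  `d_{41n} = lcm(1..41n)`): the BASELINE multiplier from Brown–Zudilin's normalisation (35) as PROVED in the tree
  (`coeffU_den_sharp`, `coeffW_den_sharp`, `coeffV_den_sharp`): `M0 n · P_n ∈ ℤ` and `M0 n · Q(a·n) ∈ ℤ` for `n ≥ 1`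
  (`M0_mul_recordP_int`, `M0_mul_recordQ_int`), `0 < M0 n`.
  Its rate is `9·41 + 12.5231 = 381.52` nats/step (`RecordRayDenominatorsSize`), far above the census's engine columns
  (64.48 with Zudilin's (8.11) as printed, 51.35 with the tree's class bounds evaluated per prime): the kernel assembly of
  those savings is the window programme of the sequel files, one `(A,B,k)` at a time.
-/

noncomputable section

open Finset Real Filter Topology

namespace Summit.KontsevichZagierPeriods.Zeta5Search.RecordRay

open Summit.KontsevichZagierPeriods.Zeta5Search.DualSeries
open Summit.KontsevichZagierPeriods.Zeta5Search.DualSeriesDenominators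
open Summit.KontsevichZagierPeriods.Zeta5Search.WedgeDictionary
open Summit.KontsevichZagierPeriods.Zeta5Search.DualSeriesLemma19 (bRecord)
open Literature.NumberTheory.Transcendental (zetaValue)

/-! ### The exponent step for a rational multiplier -/

/-- **Effective exponent from a RATIONAL multiplier.**  If eventually `0 < M_n`, `M_n·P_n ∈ ℤ`, `M_n·Q(a·n) ∈ ℤ` and
`M_n ≤ e^{λn}`, then for every `γ ≥ 0` with `γ·(λ + 85.08768884) < 85.08768883 + 31.5452`, eventually there are integers
`p_n = M_nP_n`, `q_n = M_n|Q(a·n)| ≥ 1` with `|ζ(5) − P_n/Q(a·n)| < 1/q_n^γ` (and `p_n/q_n = ±P_n/Q(a·n)`).  Decay and growth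
are the tree's certified rates (`eventually_recordForm_le_exp`, `eventually_exp_le_abs_recordQ_sharp`,
`eventually_abs_recordQ_le_exp`). -/
theorem record_exponent_rat {lam γ : ℝ} (M : ℕ → ℚ)
    (hM : ∀ᶠ n : ℕ in atTop, 0 < M n ∧ (∃ z : ℤ, M n * recordP n = z) ∧ (∃ z : ℤ, M n * recordQ n = z) ∧
      ((M n : ℚ) : ℝ) ≤ Real.exp (lam * n))
    (hγ : 0 ≤ γ) (hrate : γ * (lam + 8508768884 / 10 ^ 8) < 8508768883 / 10 ^ 8 + 315452 / 10000) :
    ∀ᶠ n : ℕ in atTop, ∃ p : ℤ, ∃ q : ℕ, 1 ≤ q ∧ (q : ℚ) = M n * |(recordQ n : ℚ)| ∧ (p : ℚ) = M n * recordP n ∧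
      |zetaValue 5 - (recordP n : ℝ) / (recordQ n : ℝ)| < 1 / (q : ℝ) ^ γ := by
  -- room ε
  set ε : ℝ := (8508768883 / 10 ^ 8 + 315452 / 10000 - γ * (lam + 8508768884 / 10 ^ 8)) / (2 * (γ + 2)) with hε
  have hεpos : 0 < ε := by rw [hε]; exact div_pos (by linarith) (by positivity)
  have hrate' : γ * (lam + (8508768884 / 10 ^ 8 + ε)) < (8508768883 / 10 ^ 8 - ε) - (-315452 / 10000 + ε) := by
    have hg2 : 0 < γ + 2 := by linarith
    have hmul : ε * (2 * (γ + 2)) = 8508768883 / 10 ^ 8 + 315452 / 10000 - γ * (lam + 8508768884 / 10 ^ 8) := by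
      rw [hε]; field_simp
    nlinarith
  have hform : ∀ᶠ n : ℕ in atTop, |(recordQ n : ℝ) * zetaValue 5 - (recordP n : ℝ)| ≤
      Real.exp ((-315452 / 10000 + ε) * n) := by
    filter_upwards [eventually_recordForm_le_exp hεpos, eventually_ge_atTop 1] with n hn hn1
    rwa [recordForm_eq hn1] at hn
  have hD' : ∀ᶠ n : ℕ in atTop, 0 < ((M n : ℚ) : ℝ) ∧ ((M n : ℚ) : ℝ) ≤ Real.exp (lam * n) := by
    filter_upwards [hM] with n hn; exact ⟨by exact_mod_cast hn.1, hn.2.2.2⟩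
  have key := abs_sub_div_lt_of_bounds (ξ := zetaValue 5) (Q := fun n => (recordQ n : ℝ))
    (P := fun n => (recordP n : ℝ)) (D := fun n => ((M n : ℚ) : ℝ)) hform
    (eventually_exp_le_abs_recordQ_sharp hεpos) (eventually_abs_recordQ_le_exp hεpos) hD' hγ hrate'
  filter_upwards [key, hM] with n hn hMn
  obtain ⟨hMpos, ⟨zP, hzP⟩, ⟨zQ, hzQ⟩, -⟩ := hMn
  have hQ : recordQ n ≠ 0 := by
    have := abs_recordQ_pos n
    intro h; rw [h] at this; simp at this
  -- q = M |Q| = |zQ|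
  refine ⟨zP, zQ.natAbs, ?_, ?_, hzP.symm, ?_⟩
  · have : zQ ≠ 0 := by
      intro h0
      rw [h0] at hzQ
      push_cast at hzQ
      rcases mul_eq_zero.1 hzQ with h1 | h1
      · exact absurd h1 hMpos.ne'
      · exact hQ (by exact_mod_cast h1)
    exact Nat.one_le_iff_ne_zero.mpr (Int.natAbs_ne_zero.mpr this)
  · rw [Nat.cast_natAbs, Int.cast_abs, ← hzQ, abs_mul, abs_of_pos hMpos]
  · have hcast : ((zQ.natAbs : ℕ) : ℝ) = ((M n : ℚ) : ℝ) * |(recordQ n : ℝ)| := by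
      rw [Nat.cast_natAbs, Int.cast_abs]
      have : ((zQ : ℤ) : ℝ) = ((M n * recordQ n : ℚ) : ℝ) := by rw [hzQ]; norm_cast
      rw [this]; push_cast
      rw [abs_mul, abs_of_pos (by exact_mod_cast hMpos : (0 : ℝ) < ((M n : ℚ) : ℝ))]
    rw [hcast]
    exact hn

/-! ### The partner parameters `b′ = b + e₇` on the ray -/

/-- `b′₀ = 41n`. -/
theorem bRecord'_zero (n : ℕ) : bRecord' n 0 = 41 * n := by
  simp [bRecord', bRecord_zero]

/-- `b′_j = b_j` for `1 ≤ j ≤ 6`. -/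
theorem bRecord'_slot (n : ℕ) {j : ℕ} (hj1 : 1 ≤ j) (hj6 : j ≤ 6) : bRecord' n j = (18 - j : ℕ) * n := by
  have h7 : j ≠ 7 := by omega
  simp [bRecord', h7, bRecord_slot n hj1 (by omega)]

/-- `b′₇ = 11n + 1`. -/
theorem bRecord'_seven (n : ℕ) : bRecord' n 7 = 11 * n + 1 := by
  simp [bRecord', bRecord_slot n (by norm_num : 1 ≤ 7) le_rfl]

/-- The partner stays in the box: `0 ≤ b′_j ≤ b′₀ + 1`. -/
theorem inBox_bRecord' (n : ℕ) : InBox (bRecord' n) := by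
  refine ⟨by rw [bRecord'_zero]; positivity, fun j hj => ?_⟩
  have hj7 : j + 1 ≤ 7 := by have := mem_range.1 hj; omega
  rcases Nat.lt_or_ge (j + 1) 7 with h | h
  · rw [bRecord'_zero, bRecord'_slot n (by omega) (by omega)]
    have : ((18 - (j + 1) : ℕ) : ℤ) ≤ 17 := by omega
    constructor
    · positivity
    · nlinarith [this, (Nat.cast_nonneg n : (0 : ℤ) ≤ n)]
  · have : j + 1 = 7 := by omega
    rw [this, bRecord'_zero, bRecord'_seven]
    constructor
    · positivity
    · have := (Nat.cast_nonneg n : (0 : ℤ) ≤ n); nlinarith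

/-- `bn b 0 = 41n` for `b = bRecord n`. -/
theorem bn_bRecord_zero (n : ℕ) : bn (bRecord n) 0 = 41 * n := by
  unfold bn; rw [bRecord_zero]; exact Int.toNat_natCast _

/-- `bn b′ 0 = 41n`. -/
theorem bn_bRecord'_zero (n : ℕ) : bn (bRecord' n) 0 = 41 * n := by
  unfold bn; rw [bRecord'_zero]; exact Int.toNat_natCast _

/-- `bn b j = (18−j)n` for `1 ≤ j ≤ 7`. -/
theorem bn_bRecord_slot (n : ℕ) {j : ℕ} (hj1 : 1 ≤ j) (hj7 : j ≤ 7) : bn (bRecord n) j = (18 - j) * n := by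
  unfold bn; rw [bRecord_slot n hj1 hj7]; exact Int.toNat_natCast _

/-- `bn b′ j = (18−j)n` for `1 ≤ j ≤ 6`. -/
theorem bn_bRecord'_slot (n : ℕ) {j : ℕ} (hj1 : 1 ≤ j) (hj6 : j ≤ 6) : bn (bRecord' n) j = (18 - j) * n := by
  unfold bn; rw [bRecord'_slot n hj1 hj6]; exact Int.toNat_natCast _

/-- `bn b′ 7 = 11n + 1`. -/
theorem bn_bRecord'_seven (n : ℕ) : bn (bRecord' n) 7 = 11 * n + 1 := by
  unfold bn; rw [bRecord'_seven]; exact Int.toNat_natCast (11 * n + 1)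

/-- The six pair conditions `b_j + b_k ≤ b₀` of the normaliser hold on the ray. -/
theorem pairs_bRecord (n : ℕ) : ∀ s, s < 6 → bn (bRecord n) (pfst s) + bn (bRecord n) (psnd s) ≤ bn (bRecord n) 0 := by
  intro s hs
  interval_cases s <;> simp only [pfst, psnd] <;>
    rw [bn_bRecord_zero, bn_bRecord_slot n (by norm_num) (by norm_num), bn_bRecord_slot n (by norm_num) (by norm_num)] <;>
    omega

/-- The six pair conditions hold for the partner (`n ≥ 1`). -/
theorem pairs_bRecord' {n : ℕ} (hn : 1 ≤ n) :
    ∀ s, s < 6 → bn (bRecord' n) (pfst s) + bn (bRecord' n) (psnd s) ≤ bn (bRecord' n) 0 := by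
  intro s hs
  interval_cases s <;> simp only [pfst, psnd]
  · rw [bn_bRecord'_zero, bn_bRecord'_slot n (by norm_num) (by norm_num), bn_bRecord'_slot n (by norm_num) (by norm_num)]
    omega
  · rw [bn_bRecord'_zero, bn_bRecord'_seven, bn_bRecord'_slot n (by norm_num) (by norm_num)]; omega
  · rw [bn_bRecord'_zero, bn_bRecord'_slot n (by norm_num) (by norm_num), bn_bRecord'_seven]; omega
  · rw [bn_bRecord'_zero, bn_bRecord'_slot n (by norm_num) (by norm_num), bn_bRecord'_slot n (by norm_num) (by norm_num)]
    omega
  · rw [bn_bRecord'_zero, bn_bRecord'_slot n (by norm_num) (by norm_num), bn_bRecord'_slot n (by norm_num) (by norm_num)]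
    omega
  · rw [bn_bRecord'_zero, bn_bRecord'_slot n (by norm_num) (by norm_num), bn_bRecord'_slot n (by norm_num) (by norm_num)]
    omega

/-- `Σ_j b_j ≤ 3b₀ + 1` on the ray. -/
theorem sum_bRecord_le (n : ℕ) : ∑ j ∈ range 7, bRecord n (j + 1) ≤ 3 * bRecord n 0 + 1 := by
  simp only [sum_range_succ, sum_range_zero, bRecord_zero]
  rw [bRecord_slot n (by norm_num) (by norm_num), bRecord_slot n (by norm_num) (by norm_num),
    bRecord_slot n (by norm_num) (by norm_num), bRecord_slot n (by norm_num) (by norm_num),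
    bRecord_slot n (by norm_num) (by norm_num), bRecord_slot n (by norm_num) (by norm_num),
    bRecord_slot n (by norm_num) (by norm_num)]
  push_cast; nlinarith [(Nat.cast_nonneg n : (0 : ℤ) ≤ n)]

/-- `Σ_j b′_j ≤ 3b′₀ + 1` on the ray. -/
theorem sum_bRecord'_le (n : ℕ) : ∑ j ∈ range 7, bRecord' n (j + 1) ≤ 3 * bRecord' n 0 + 1 := by
  simp only [sum_range_succ, sum_range_zero, bRecord'_zero]
  rw [bRecord'_slot n (by norm_num) (by norm_num), bRecord'_slot n (by norm_num) (by norm_num),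
    bRecord'_slot n (by norm_num) (by norm_num), bRecord'_slot n (by norm_num) (by norm_num),
    bRecord'_slot n (by norm_num) (by norm_num), bRecord'_slot n (by norm_num) (by norm_num), bRecord'_seven]
  push_cast; nlinarith [(Nat.cast_nonneg n : (0 : ℤ) ≤ n)]

/-! ### The baseline multiplier `M0` -/

/-- `d_{41n} = lcm(1, …, 41n)` as a rational number. -/
def dRec (n : ℕ) : ℚ := ((Nat.lcmUpto (41 * n) : ℕ) : ℚ)

/-- `0 < d_{41n}`. -/
theorem dRec_pos (n : ℕ) : 0 < dRec n := by
  unfold dRec; exact_mod_cast Nat.lcmUpto_pos _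

/-- **The baseline multiplier** `M0 n = d_{41n}⁹ · N♯(b) · N♯(b′) / |ρ(a·n)|`. -/
def M0 (n : ℕ) : ℚ :=
  dRec n ^ 9 * sharpNormaliser (bRecord n) * sharpNormaliser (bRecord' n) / |rhoOf (aRec n)|

/-- `N♯(b) > 0` for every `b` (a ratio of factorials). -/
theorem sharpNormaliser_pos (b : ℕ → ℤ) : 0 < sharpNormaliser b := by
  unfold sharpNormaliser normaliser
  apply div_pos
  · exact_mod_cast prod_pos fun s _ => Nat.factorial_pos _
  · exact_mod_cast mul_pos (Nat.factorial_pos _) (Nat.factorial_pos _)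

/-- `ρ(a·n) ≠ 0`. -/
theorem rhoOf_aRec_ne_zero (n : ℕ) : rhoOf (aRec n) ≠ 0 := by
  have h := abs_rhoOf_aRec n
  intro h0
  rw [h0] at h
  simp only [Rat.cast_zero, abs_zero] at h
  have hpos : (0 : ℝ) < ((((8 * n).factorial : ℕ) : ℝ) * (((9 * n).factorial : ℕ) : ℝ) * (((10 * n).factorial : ℕ) : ℝ) *
      (((11 * n).factorial : ℕ) : ℝ) * (((10 * n).factorial : ℕ) : ℝ) * (((11 * n).factorial : ℕ) : ℝ) *
      (((12 * n).factorial : ℕ) : ℝ) * (((13 * n).factorial : ℕ) : ℝ) * (((12 * n).factorial : ℕ) : ℝ) *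
      (((14 * n).factorial : ℕ) : ℝ) * (((15 * n).factorial : ℕ) : ℝ) * (((16 * n).factorial : ℕ) : ℝ) *
      (((16 * n).factorial : ℕ) : ℝ) * (((17 * n).factorial : ℕ) : ℝ) * (((18 * n).factorial : ℕ) : ℝ)) /
      (4 * ((((17 * n).factorial : ℕ) : ℝ) * (((14 * n).factorial : ℕ) : ℝ) * (((13 * n).factorial : ℕ) : ℝ) *
        (((12 * n).factorial : ℕ) : ℝ) * (((11 * n).factorial : ℕ) : ℝ)) * (((25 * n).factorial : ℕ) : ℝ)) := by
    positivity
  linarith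

/-- `0 < M0 n`. -/
theorem M0_pos (n : ℕ) : 0 < M0 n := by
  unfold M0
  apply div_pos
  · exact mul_pos (mul_pos (pow_pos (dRec_pos n) 9) (sharpNormaliser_pos _)) (sharpNormaliser_pos _)
  · exact abs_pos.2 (rhoOf_aRec_ne_zero n)

/-- The integer numerators of Brown–Zudilin's (35) on the ray: `d·N♯(b)·U(b)`, `d³·N♯(b)·W(b)`, `d⁶·N♯(b)·V(b) ∈ ℤ`,
at `b = bRecord n` and at the partner `b′`. -/
theorem sharp_ints {n : ℕ} (hn : 1 ≤ n) :
    (∃ z : ℤ, dRec n * sharpNormaliser (bRecord n) * coeffU (bRecord n) = z) ∧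
    (∃ z : ℤ, dRec n ^ 3 * sharpNormaliser (bRecord n) * coeffW (bRecord n) = z) ∧
    (∃ z : ℤ, dRec n ^ 6 * sharpNormaliser (bRecord n) * coeffV (bRecord n) = z) ∧
    (∃ z : ℤ, dRec n * sharpNormaliser (bRecord' n) * coeffU (bRecord' n) = z) ∧
    (∃ z : ℤ, dRec n ^ 3 * sharpNormaliser (bRecord' n) * coeffW (bRecord' n) = z) ∧
    (∃ z : ℤ, dRec n ^ 6 * sharpNormaliser (bRecord' n) * coeffV (bRecord' n) = z) := by
  have h1 := coeffU_den_sharp (inBox_bRecord n) (pairs_bRecord n) (sum_bRecord_le n)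
  have h2 := coeffW_den_sharp (inBox_bRecord n) (pairs_bRecord n) (sum_bRecord_le n)
  have h3 := coeffV_den_sharp (inBox_bRecord n) (pairs_bRecord n) (sum_bRecord_le n)
  have h4 := coeffU_den_sharp (inBox_bRecord' n) (pairs_bRecord' hn) (sum_bRecord'_le n)
  have h5 := coeffW_den_sharp (inBox_bRecord' n) (pairs_bRecord' hn) (sum_bRecord'_le n)
  have h6 := coeffV_den_sharp (inBox_bRecord' n) (pairs_bRecord' hn) (sum_bRecord'_le n)
  rw [bn_bRecord_zero] at h1 h2 h3
  rw [bn_bRecord'_zero] at h4 h5 h6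
  exact ⟨h1, h2, h3, h4, h5, h6⟩

/-- `ρ/|ρ|` is `±1`: for `ρ ≠ 0` there is `s ∈ {1, −1}` (an integer) with `ρ = s·|ρ|`. -/
theorem exists_sign_mul_abs (x : ℚ) (hx : x ≠ 0) : ∃ s : ℤ, (s = 1 ∨ s = -1) ∧ x = s * |x| := by
  rcases lt_or_gt_of_ne hx with h | h
  · exact ⟨-1, Or.inr rfl, by rw [abs_of_neg h]; push_cast; ring⟩
  · exact ⟨1, Or.inl rfl, by rw [abs_of_pos h]; push_cast; ring⟩

/-- **`M0 n · P_n ∈ ℤ`** (`n ≥ 1`): `M0·P = ±[(d³N♯(b′)W(b′))(d⁶N♯(b)V(b)) − (d³N♯(b)W(b))(d⁶N♯(b′)V(b′))]`. -/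
theorem M0_mul_recordP_int {n : ℕ} (hn : 1 ≤ n) : ∃ z : ℤ, M0 n * recordP n = z := by
  obtain ⟨-, ⟨zW, hzW⟩, ⟨zV, hzV⟩, -, ⟨zW', hzW'⟩, ⟨zV', hzV'⟩⟩ := sharp_ints hn
  obtain ⟨s, hs, hρ⟩ := exists_sign_mul_abs _ (rhoOf_aRec_ne_zero n)
  have habs : |rhoOf (aRec n)| ≠ 0 := abs_ne_zero.2 (rhoOf_aRec_ne_zero n)
  have hdiv : rhoOf (aRec n) / |rhoOf (aRec n)| = s := by rw [div_eq_iff habs]; exact hρ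
  refine ⟨s * (zW' * zV - zW * zV'), ?_⟩
  have key : M0 n * recordP n = (rhoOf (aRec n) / |rhoOf (aRec n)|) *
      ((dRec n ^ 3 * sharpNormaliser (bRecord' n) * coeffW (bRecord' n)) *
      (dRec n ^ 6 * sharpNormaliser (bRecord n) * coeffV (bRecord n)) -
      (dRec n ^ 3 * sharpNormaliser (bRecord n) * coeffW (bRecord n)) *
      (dRec n ^ 6 * sharpNormaliser (bRecord' n) * coeffV (bRecord' n))) := by
    unfold M0 recordP
    field_simp
  rw [hdiv] at key
  rw [key, hzW, hzV, hzW', hzV']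
  push_cast; ring

/-- **`M0 n · Q(a·n) ∈ ℤ`** (`n ≥ 1`): by the Q-part of the wedge dictionary
`Q(a·n) = ρ·(U(b)W(b′) − U(b′)W(b))`, `M0·Q = ± d⁵·[(dN♯(b)U(b))(d³N♯(b′)W(b′)) − (dN♯(b′)U(b′))(d³N♯(b)W(b))]`. -/
theorem M0_mul_recordQ_int {n : ℕ} (hn : 1 ≤ n) : ∃ z : ℤ, M0 n * recordQ n = z := by
  obtain ⟨⟨zU, hzU⟩, ⟨zW, hzW⟩, -, ⟨zU', hzU'⟩, ⟨zW', hzW'⟩, -⟩ := sharp_ints hn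
  obtain ⟨s, hs, hρ⟩ := exists_sign_mul_abs _ (rhoOf_aRec_ne_zero n)
  have habs : |rhoOf (aRec n)| ≠ 0 := abs_ne_zero.2 (rhoOf_aRec_ne_zero n)
  have hdiv : rhoOf (aRec n) / |rhoOf (aRec n)| = s := by rw [div_eq_iff habs]; exact hρ
  obtain ⟨D, hD⟩ : ∃ D : ℕ, dRec n = (D : ℚ) := ⟨Nat.lcmUpto (41 * n), rfl⟩
  refine ⟨s * D ^ 5 * (zU * zW' - zU' * zW), ?_⟩
  have hQ := recordQ_eq_wedge hn
  have key : M0 n * recordQ n = (rhoOf (aRec n) / |rhoOf (aRec n)|) * dRec n ^ 5 *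
      ((dRec n * sharpNormaliser (bRecord n) * coeffU (bRecord n)) *
      (dRec n ^ 3 * sharpNormaliser (bRecord' n) * coeffW (bRecord' n)) -
      (dRec n * sharpNormaliser (bRecord' n) * coeffU (bRecord' n)) *
      (dRec n ^ 3 * sharpNormaliser (bRecord n) * coeffW (bRecord n))) := by
    unfold M0
    rw [hQ]
    field_simp
  rw [hdiv] at key
  rw [key, hzU, hzW, hzU', hzW', hD]
  push_cast; ring

end Summit.KontsevichZagierPeriods.Zeta5Search.RecordRay
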